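import Mathlib

/-!
# Hodge-locus census, V3-XT N = 1 — LEMMA 1 for EVERY tower and EVERY depth: `S(ℤ[c] + λ·O) = ℤ·s_c + λ·S(O)`

certified instances and evidence bearing on the general Hodge conjecture; no claim.

The depth towers of the `ℓ`-inert census rows (THEOREM-sketch D7I and its engine-B countersign, D7I-bis, ROW 11 /
THEOREM D11, D11-bis; notes `code/abs_engineB/v3B/xt/n1inert7/DERIVATION-D7I-B.md` §7, `…/n1inert11/DERIVATION-D11I-B.md` §1)
all use one lemma: for an order `O` of a quaternion algebra, an element `c ∈ O` and the order `R = ℤ[c] + ℓ^k·O`, the GROSS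
LATTICE `S(R) := {trace-zero elements of ℤ + 2R}` equals `ℤ·s_c + ℓ^k·S(O)` with `s_c := 2c − trd c`.  The engines
machine-checked it lattice by lattice for `k ≤ 3` (mutual containment of HNF bases); `HodgeLocusCensusInert7BTower` proved the
instance `O ⊂ (-1,-7)`, `c = i` for all `k` with the explicit hand form.

This file proves the lemma ONCE FOR ALL TOWERS, in coordinates: vectors `v : Fin 4 → ℚ` w.r.t. any basis `1, e₁, e₂, e₃` of the
algebra with `trd v = 2·v 0` and pure part `(v 1, v 2, v 3)` (true for `1, i, j, k` of any `(a,b)_ℚ`).  No multiplication is needed: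
the statement is about `ℤ`-modules and the trace, so `O` may be ANY subset whose elements have integral reduced trace, `c` any
element of `O`, and the scalar `lam` any integer (the rows use `lam = ℓ^k`).
* `Rset O c lam`  : coordinate vectors of `ℤ + ℤ·c + λ·O` (= `ℤ[c] + λ·O` as a `ℤ`-module when `c` is integral quadratic);
* `Sof X`       : the Gross lattice of `X` — pure parts `(2v₁, 2v₂, 2v₃)` of the `x = n + 2v`, `n ∈ ℤ`, `v ∈ X`, with `trd x = 0`;
* `sVec c`      : the pure part of `s_c = 2c − trd c`;
* `mem_Sof_tower_iff` : `s ∈ Sof (Rset O c lam) ↔ ∃ m : ℤ, ∃ t ∈ Sof O, s = m·sVec c + λ·t`  — LEMMA 1, every tower, every depth.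
Nothing here is a statement about algebraic cycles.
-/

set_option linter.dupNamespace false

namespace Summit.HodgeConjecture.HodgeConjecture.HodgeLocus.Census.GrossLatticeTowerLemma

/-- Coordinate vectors (w.r.t. `1, e₁, e₂, e₃`) of the `ℤ`-module `ℤ·1 + ℤ·c + λ·O`. -/
def Rset (O : Set (Fin 4 → ℚ)) (c : Fin 4 → ℚ) (lam : ℤ) : Set (Fin 4 → ℚ) :=
  {v | ∃ (a b : ℤ) (β : Fin 4 → ℚ), β ∈ O ∧ v = (a : ℚ) • ![1, 0, 0, 0] + (b : ℚ) • c + (lam : ℚ) • β}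

/-- The Gross lattice of `X` in pure coordinates: `{(2v₁, 2v₂, 2v₃) : n ∈ ℤ, v ∈ X, n + 2v₀ = 0}` (the trace-zero part of `ℤ + 2X`). -/
def Sof (X : Set (Fin 4 → ℚ)) : Set (Fin 3 → ℚ) :=
  {s | ∃ (n : ℤ) (v : Fin 4 → ℚ), v ∈ X ∧ (n : ℚ) + 2 * v 0 = 0 ∧ s = ![2 * v 1, 2 * v 2, 2 * v 3]}

/-- Pure part of `s_c = 2c − trd c`. -/
def sVec (c : Fin 4 → ℚ) : Fin 3 → ℚ := ![2 * c 1, 2 * c 2, 2 * c 3]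

/-- LEMMA 1 (every tower `ℤ[c] + λ·O`, every `λ ∈ ℤ`): if every element of `O` has integral reduced trace and `c ∈ O`, then
`S(ℤ + ℤc + λO) = ℤ·s_c + λ·S(O)`. -/
theorem mem_Sof_tower_iff (O : Set (Fin 4 → ℚ)) (hO : ∀ β ∈ O, ∃ t : ℤ, 2 * β 0 = t) (c : Fin 4 → ℚ) (hc : c ∈ O)
    (lam : ℤ) (s : Fin 3 → ℚ) :
    s ∈ Sof (Rset O c lam) ↔ ∃ (m : ℤ) (t : Fin 3 → ℚ), t ∈ Sof O ∧ s = (m : ℚ) • sVec c + (lam : ℚ) • t := by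
  constructor
  · rintro ⟨n, v, ⟨a, b, β, hβ, hv⟩, _htr, hs⟩
    obtain ⟨tβ, htβ⟩ := hO β hβ
    refine ⟨b, ![2 * β 1, 2 * β 2, 2 * β 3], ⟨-tβ, β, hβ, ?_, rfl⟩, ?_⟩
    · push_cast; linarith
    · subst hs; subst hv
      ext i; fin_cases i <;>
        simp [sVec, Matrix.vecHead, Matrix.vecTail, Pi.add_apply, Pi.smul_apply, smul_eq_mul] <;> ring
  · rintro ⟨m, t, ⟨n', β, hβ, hn', ht⟩, hs⟩
    obtain ⟨tc, htc⟩ := hO c hc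
    subst ht; subst hs
    refine ⟨-(m * tc) + lam * n', (m : ℚ) • c + (lam : ℚ) • β, ⟨0, m, β, hβ, by simp⟩, ?_, ?_⟩
    · simp only [Pi.add_apply, Pi.smul_apply, smul_eq_mul]
      push_cast
      linear_combination (m : ℚ) * htc + (lam : ℚ) * hn'
    · ext i; fin_cases i <;>
        simp [sVec, Pi.add_apply, Pi.smul_apply, smul_eq_mul] <;> ring

/-- The hypothesis of LEMMA 1 for the maximal order `O = ℤ⟨1, i, (1+j)/2, (i+k)/2⟩` used at `ℓ = 7` and (as `O_1728`) at `ℓ = 11`: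
its elements `(a + c/2, b + d/2, c/2, d/2)` have reduced trace `2a + c ∈ ℤ`. -/
theorem trace_integral_O1728 (a b c d : ℤ) :
    ∃ t : ℤ, 2 * (![(a : ℚ) + c / 2, (b : ℚ) + d / 2, (c : ℚ) / 2, (d : ℚ) / 2] : Fin 4 → ℚ) 0 = t :=
  ⟨2 * a + c, by simp; ring⟩

/-- … and for the second maximal order `O_0 = ℤ⟨(1+j+2k)/2, (i+2j+5k)/4, j, 2k⟩` of `(-1,-11)` (engine B's HNF basis, `q11lat.find_O0`):
an element `p·(1+j+2k)/2 + q·(i+2j+5k)/4 + r·j + s·2k` has reduced trace `p ∈ ℤ`. -/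
theorem trace_integral_O0 (p q r s : ℤ) :
    ∃ t : ℤ, 2 * (![(p : ℚ) / 2, (q : ℚ) / 4, (p : ℚ) / 2 + q / 2 + r, (p : ℚ) + 5 * q / 4 + 2 * s] : Fin 4 → ℚ) 0 = t :=
  ⟨p, by simp; ring⟩

end Summit.HodgeConjecture.HodgeConjecture.HodgeLocus.Census.GrossLatticeTowerLemma
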